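import Summits.ValiantsHypothesis.ValiantsHypothesis.Theorems.DivisionGapPerDivisionHardStubSubexpRigid

/-!
# Crux `DivisionGap.PerDivisionHard` (stmt-ValiantsHypothesis-5065), line `pair-descent-jss-endpoint` —
stub `stub_decidedAtoms`: a LARGE block deciding every sparse torus-homogeneous atom

`stub_decidedAtoms`: there are `e n₀` such that for `n ≥ n₀` and every finite family of
torus-homogeneous atoms `F_β ∈ ℝ≥0[x_ij]` with `Σ_β |supp F_β|² ≤ 2^{⌊√n⌋/(log₂ n + e)^e}` there
are a placement `eR eC` of some block arsenal `G(b,k) ⊕ M₀` with `n ≤ b⁴` and a weight `w`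
cutting out the placed face under which every atom is DECIDED: its top-`w` fibre has at most one
monomial.

This is the counting of `stub_subexpRigid` / `stub_atomicRigid`
(`Theorems/DivisionGapPerDivisionHardStubSubexpRigid.lean`, `…StubAtomicRigid.lean`) with the bad
family of the row sets of INTERNAL PAIRS only, in a large-block regime.  Parameters:
`s = ⌊√n⌋`, `t = ⌊√s⌋`, `b = t + 1` (so `n < (s+1)² ≤ b⁴` and `b² ≤ 4s`), `k = s / 16 ≥ 1`,
`N = b + b²k` corner rows, `t₀ = 4k + 2`, `e = 4` (so `x := s / (log₂ n + 4)^4 ≤ s / 16 = k`),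
`n ≥ 4096`.
1. BAD FAMILY of row sets: the rows where two monomials `f, f'` of one atom `F_β` differ (at most
   `Σ_β |supp F_β|² ≤ 2^x ≤ 2^{t₀}` sets), so by `exists_goodSubset` / `count_lt` some `N`-set `R`
   of rows contains no bad set of size `≥ t₀`; label the rows so that the core and internal
   labels land in `R` (`exists_blockEquiv`).
2. The generic weight `w = genericWeight G B` with radix `B = 1 + Σ_β deg F_β` (exceeding every
   exponent occurring in an atom) cuts out the placed graph `G` (`cutsOut_genericWeight` via
   `exists_blockMatching`, `exists_perm_mem_placedBlock`).  EXCLUSION: an integer matrix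
   supported on `G` with vanishing margins whose row set is bad vanishes — otherwise it occupies
   `≥ 4k + 2` rows (`placedFlow_card_rows`), all of them in `R` (`placedFlow_row_notPadding`).
3. Two monomials of `top_w F_β` have equal weight (`weight_eq_of_mem_support_topComponent`) and
   equal degree (`F_β` torus-homogeneous, `degree_eq_of_rowDegrees_eq`), hence agree off `G`
   (`weight_add_offDigitSum`, `eq_offG_of_offDigitSum_eq`); their difference is a circulation in
   `G` (`sum_diff_eq_zero`) with bad row set, so they coincide.
-/

noncomputable section

-- `Summit.ValiantsHypothesis.ValiantsHypothesis.…` is the tree's mandated single-conjunct layout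
-- (Sub = Summit), so the duplicated namespace component is intended.
set_option linter.dupNamespace false

namespace Summit.ValiantsHypothesis.ValiantsHypothesis.Theorems.DivisionGapPerDivisionHard

open MvPolynomial Literature.Computability.AlgebraicComplexity
open Summit.ValiantsHypothesis.ValiantsHypothesis.Theorems.ZeroOneTransfer.Negative
open scoped NNReal

/-- **`stub_decidedAtoms` (v8 of line `pair-descent-jss-endpoint`) — a LARGE block deciding every
sparse atom.**  There are `e, n₀` such that for `n ≥ n₀` and every finite family of
torus-homogeneous atoms `F_β` with `Σ_β |supp F_β|² ≤ 2^{⌊√n⌋/(log₂ n + e)^e}` there are a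
placement of some `G(b,k) ⊕ M₀` with `n ≤ b⁴` and a weight `w` cutting it out under which every
atom is decided: its top-`w` fibre has at most one monomial.  Parameters `b = ⌊√⌊√n⌋⌋ + 1`,
`k = ⌊√n⌋ / 16`, `e = 4`, `n₀ = 4096`; placement by counting (`exists_goodSubset`, `count_lt`,
`exists_blockEquiv`) against the row sets of internal pairs; generic weight with radix
`B = 1 + Σ_β deg F_β` (`cutsOut_genericWeight`); two fibre monomials of one atom agree off `G`
(`weight_add_offDigitSum`, `eq_offG_of_offDigitSum_eq`) and differ by a circulation in `G`,
excluded by the girth substitute `placedFlow_card_rows` / `placedFlow_row_notPadding`.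
[folklore] -/
theorem stub_decidedAtoms :
    ∃ e n₀ : ℕ, ∀ n ≥ n₀, ∀ (ι : Type) (I : Finset ι)
      (F : ι → MvPolynomial (Fin n × Fin n) ℝ≥0),
      (∀ β ∈ I, IsTorusHomogeneous (F β)) →
      (∑ β ∈ I, (F β).support.card ^ 2) ≤ 2 ^ (Nat.sqrt n / (Nat.log 2 n + e) ^ e) →
      ∃ (b k m : ℕ) (eR eC : BlockV b k m ≃ Fin n) (w : Fin n × Fin n → ℕ),
        n ≤ b ^ 4 ∧ CutsOut w (placedBlock eR eC) ∧
        ∀ β ∈ I, ∀ f ∈ (topComponent w (F β)).support,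
          ∀ f' ∈ (topComponent w (F β)).support, f = f' := by
  refine ⟨4, 4096, fun n hn ι I F hFtor hIcard => ?_⟩
  classical
  -- the parameters: `s = ⌊√n⌋`, `t = ⌊√s⌋`, `b = t + 1`, `k = s / 16`
  have hs64 : 64 ≤ Nat.sqrt n := Nat.le_sqrt.2 (le_trans (by norm_num) hn)
  have hsn : Nat.sqrt n * Nat.sqrt n ≤ n := Nat.sqrt_le n
  have hns : n < (Nat.sqrt n + 1) * (Nat.sqrt n + 1) := Nat.lt_succ_sqrt n
  generalize Nat.sqrt n = s at hs64 hsn hns hIcard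
  have ht8 : 8 ≤ Nat.sqrt s := Nat.le_sqrt.2 (le_trans (by norm_num) hs64)
  have hts : Nat.sqrt s * Nat.sqrt s ≤ s := Nat.sqrt_le s
  have hst : s < (Nat.sqrt s + 1) * (Nat.sqrt s + 1) := Nat.lt_succ_sqrt s
  have htle : Nat.sqrt s ≤ s := Nat.sqrt_le_self s
  generalize Nat.sqrt s = t at ht8 hts hst htle
  set b := t + 1 with hb
  have hb4 : n ≤ b ^ 4 :=
    calc n ≤ (s + 1) * (s + 1) := hns.le
      _ ≤ (b * b) * (b * b) := Nat.mul_le_mul (Nat.succ_le_of_lt hst) (Nat.succ_le_of_lt hst)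
      _ = b ^ 4 := by ring
  have hbb : b * b ≤ 4 * s :=
    calc b * b ≤ (2 * t) * (2 * t) := Nat.mul_le_mul (by omega) (by omega)
      _ = 4 * (t * t) := by ring
      _ ≤ 4 * s := Nat.mul_le_mul_left 4 hts
  have h16s : 16 * s ≤ n := le_trans (Nat.mul_le_mul_right s (by omega)) hsn
  -- the subdivision length `k = s / 16`
  have hk16 : s / 16 * 16 ≤ s := Nat.div_mul_le_self s 16
  have hk : 0 < s / 16 := Nat.div_pos (by omega) (by norm_num)
  have hx : s / (Nat.log 2 n + 4) ^ 4 ≤ s / 16 :=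
    Nat.div_le_div_left
      (le_trans (by norm_num : 16 ≤ 2 ^ 4) (Nat.pow_le_pow_left (by omega) 4)) (by norm_num)
  set k := s / 16 with hkdef
  have hsk : 16 * (s * k) ≤ n :=
    calc 16 * (s * k) = s * (k * 16) := by ring
      _ ≤ s * s := Nat.mul_le_mul_left s hk16
      _ ≤ n := hsn
  have hK : b * (b * k) ≤ 4 * (s * k) :=
    calc b * (b * k) = (b * b) * k := (Nat.mul_assoc b b k).symm
      _ ≤ (4 * s) * k := Nat.mul_le_mul_right k hbb
      _ = 4 * (s * k) := Nat.mul_assoc 4 s k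
  have hK' : s * k + k ≤ b * (b * k) :=
    calc s * k + k = (s + 1) * k := (Nat.succ_mul s k).symm
      _ ≤ (b * b) * k := Nat.mul_le_mul_right k (Nat.succ_le_of_lt hst)
      _ = b * (b * k) := Nat.mul_assoc b b k
  have h16k : 16 * k ≤ s * k := Nat.mul_le_mul_right k (by omega)
  have h2N : 2 * (b + b * (b * k)) + (4 * k + 2) ≤ n := by omega
  have ht₀N : 4 * k + 2 ≤ b + b * (b * k) := by omega
  -- the bad family of row sets: internal pairs of an atom
  let rowsZ : (Fin n × Fin n → ℤ) → Finset (Fin n) := fun D =>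
    Finset.univ.filter fun r => ∃ c, D (r, c) ≠ 0
  let P₁ : Finset (Finset (Fin n)) := I.biUnion fun β =>
    ((F β).support ×ˢ (F β).support).image fun p => rowsZ fun e => (p.1 e : ℤ) - p.2 e
  set P := P₁.filter fun T => 4 * k + 2 ≤ T.card with hP
  have hP₁ : P₁.card ≤ 2 ^ (4 * k + 2) :=
    calc P₁.card ≤ ∑ β ∈ I, (((F β).support ×ˢ (F β).support).image fun p =>
          rowsZ fun e => (p.1 e : ℤ) - p.2 e).card := Finset.card_biUnion_le
      _ ≤ ∑ β ∈ I, (F β).support.card ^ 2 := Finset.sum_le_sum fun β _ =>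
          Finset.card_image_le.trans (by rw [Finset.card_product, sq])
      _ ≤ 2 ^ (s / (Nat.log 2 n + 4) ^ 4) := hIcard
      _ ≤ 2 ^ (4 * k + 2) := Nat.pow_le_pow_right two_pos (by omega)
  have hPcard : P.card ≤ 2 ^ (4 * k + 2) := (Finset.card_filter_le _ _).trans hP₁
  -- a good set of `N = b + b²k` corner rows and the placement
  obtain ⟨R, hRcard, hRgood⟩ := exists_goodSubset P (fun T => T) (b + b * (b * k)) (4 * k + 2)
    (fun p hp => (Finset.mem_filter.mp hp).2)
    (by rw [Fintype.card_fin]; exact count_lt (by omega) ht₀N hPcard h2N)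
  obtain ⟨eR, heR₁, heR₂⟩ :=
    exists_blockEquiv R b k (n - (b + b * (b * k))) hRcard (by rw [hRcard])
  set G := placedBlock eR eR with hG
  set B := (∑ β ∈ I, (F β).totalDegree) + 1 with hB
  have hB0 : 0 < B := Nat.succ_pos _
  -- the generic weight cuts out `G`
  obtain ⟨g, hg⟩ := exists_blockMatching b k (n - (b + b * (b * k))) hk
  obtain ⟨σ₀, hσ₀⟩ := exists_perm_mem_placedBlock eR eR g hg
  have hcut : CutsOut (genericWeight G B) G := cutsOut_genericWeight G hB0 σ₀ hσ₀
  -- exclusion: an integer matrix supported on `G` with vanishing margins whose row set belongs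
  -- to the bad family vanishes (else it occupies `≥ 4k + 2` rows, all of them in `R`)
  have hexcl : ∀ D : Fin n × Fin n → ℤ, (∀ e, D e ≠ 0 → e ∈ G) → (∀ r, ∑ c, D (r, c) = 0) →
      (∀ c, ∑ r, D (r, c) = 0) → rowsZ D ∈ P₁ → ∀ e, D e = 0 := by
    intro D hDG hrow hcol hmem
    by_contra hne
    push Not at hne
    have hrows := placedFlow_card_rows eR eR hk hDG hrow hcol hne
    refine hRgood (rowsZ D) (Finset.mem_filter.mpr ⟨hmem, hrows⟩) fun r hr => ?_
    obtain ⟨c', hc'⟩ := (Finset.mem_filter.mp hr).2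
    have hpad := placedFlow_row_notPadding eR eR hDG hrow hcol hc'
    obtain ⟨y, rfl⟩ := eR.surjective r
    rcases y with i | p | u
    · exact heR₁ i
    · exact heR₂ p
    · exact absurd (eR.symm_apply_apply _) (hpad u)
  -- every exponent occurring in an atom is `< B`
  have hlt : ∀ β ∈ I, ∀ f ∈ (F β).support, ∀ e, f e < B := fun β hβ f hf e =>
    Nat.lt_succ_of_le (((Finsupp.le_degree e f).trans (le_totalDegree hf)).trans
      (Finset.single_le_sum (f := fun β => (F β).totalDegree) (fun _ _ => Nat.zero_le _) hβ))
  -- conclusion: every atom's top fibre is a single monomial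
  refine ⟨b, k, n - (b + b * (b * k)), eR, eR, genericWeight G B, hb4, hcut,
    fun β hβ f hf f' hf' => ?_⟩
  have hs := support_topComponent_subset _ _ hf
  have hs' := support_topComponent_subset _ _ hf'
  obtain ⟨r₀, c₀, hrc⟩ := hFtor β hβ
  have hdeg : f.degree = f'.degree :=
    degree_eq_of_rowDegrees_eq ((hrc f hs).1.trans (hrc f' hs').1.symm)
  have hw := weight_eq_of_mem_support_topComponent _ _ hf
  have hw' := weight_eq_of_mem_support_topComponent _ _ hf'
  have e₁ := weight_add_offDigitSum G hB0 f
  have e₂ := weight_add_offDigitSum G hB0 f'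
  rw [hdeg] at e₁
  have hoff : ∀ e ∉ G, f e = f' e :=
    eq_offG_of_offDigitSum_eq G (hlt β hβ f hs) (hlt β hβ f' hs') (by omega)
  obtain ⟨hrow, hcol⟩ := sum_diff_eq_zero ((hrc f hs).1.trans (hrc f' hs').1.symm)
    ((hrc f hs).2.trans (hrc f' hs').2.symm)
  have hDG : ∀ e, (fun e => (f e : ℤ) - f' e) e ≠ 0 → e ∈ G := fun e he => by
    by_contra heG
    exact he (by simp only [hoff e heG, sub_self])
  have hmem : rowsZ (fun e => (f e : ℤ) - f' e) ∈ P₁ :=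
    Finset.mem_biUnion.mpr ⟨β, hβ, Finset.mem_image_of_mem _ (Finset.mk_mem_product hs hs')⟩
  have h0 := hexcl _ hDG hrow hcol hmem
  exact Finsupp.ext fun e => by exact_mod_cast sub_eq_zero.mp (h0 e)

end Summit.ValiantsHypothesis.ValiantsHypothesis.Theorems.DivisionGapPerDivisionHard

end
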